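import Literature.Computability.Complexity.GateEliminationCases5to8Split

/-!
# Gate elimination: splitting Case 5 of Li–Yang's Theorem 4.1

Case 5 of §4.1 (ECCC TR21-023, pp. 27–33): "There is an ∧-type gate `G` fed by two `2`-variable
`x` and `y`. By Case 3, `G` must be a `1`-gate, and hence troubled. Since the circuit is
normalized we know that `B ≠ D` and `C ≠ D`" (`B`, `C` the other readers of `x`, `y`; `D` the
reader of `G`). The printed proof splits on the wiring between `B`, `C`, `D`:

* Case 5.1: `B = C`;
* Case 5.2: `D` feeds both `B` and `C`;
* Case 5.3: `C` feeds `D` and `D` feeds `B` (or symmetrically);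
* Case 5.4: `D` is disconnected (in both directions) with `B` (by symmetry).

This file names the four sub-claims (`LiYang2022_case5_1` … `LiYang2022_case5_4`, over the
configuration `Semicircuit.Case5Config`) and PROVES that they imply `LiYang2022_case5`
(`LiYang2022_case5_of_split`: the configuration from a troubled gate under the standing
assumptions, and the printed case distinction with the `x ↔ y` symmetry).

## References

* J. Li, T. Yang, *3.1n − o(n) circuit lower bounds for explicit functions*, STOC 2022;
  ECCC TR21-023, §4.1 (Case 5).
-/

namespace Literature.Computability.Complexity

open Finset

namespace Semicircuit

variable {n : ℕ}

/-- **The configuration of Case 5**: an ∧-type `1`-gate `G` reading the distinct `2`-variables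
`x` (at `aX`) and `y`; `B ≠ G` the other reader of `x`, `C' ≠ G` the other reader of `y`, `D` the
reader of `G` (Li–Yang Figure 15). [cite: LiYang2022, §4.1 (Case 5), Figure 15] -/
structure Case5Config (C : Semicircuit n) (G : Fin C.m) (x y : Fin n) (B C' D : Fin C.m) (aX aB aC aD : Fin 2) : Prop where
  /-- `G` is ∧-type -/
  and_G : IsAndOp (C.op G)
  /-- `G` reads `x` -/
  arg_G_x : C.arg G aX = .var x
  /-- `G` reads `y` -/
  arg_G_y : C.arg G aX.rev = .var y
  /-- `x ≠ y` -/
  x_ne_y : x ≠ y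
  /-- `x` is a `2`-variable -/
  fanout_x : C.fanout (.var x) = 2
  /-- `y` is a `2`-variable -/
  fanout_y : C.fanout (.var y) = 2
  /-- `G` is a `1`-gate -/
  fanout_G : C.fanout (.gate G) = 1
  /-- `B` reads `x` -/
  arg_B : C.arg B aB = .var x
  /-- `B ≠ G` -/
  B_ne_G : B ≠ G
  /-- `C'` reads `y` -/
  arg_C : C.arg C' aC = .var y
  /-- `C' ≠ G` -/
  C_ne_G : C' ≠ G
  /-- `D` reads `G` -/
  arg_D : C.arg D aD = .gate G

namespace Case5Config

variable {C : Semicircuit n} {G : Fin C.m} {x y : Fin n} {B C' D : Fin C.m} {aX aB aC aD : Fin 2}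
  (h : C.Case5Config G x y B C' D aX aB aC aD)
include h

/-- The symmetric configuration (`x ↔ y`, `B ↔ C'`). [folklore] -/
theorem symm : C.Case5Config G y x C' B D aX.rev aC aB aD :=
  { and_G := h.and_G
    arg_G_x := h.arg_G_y
    arg_G_y := by rw [Fin.rev_rev]; exact h.arg_G_x
    x_ne_y := h.x_ne_y.symm
    fanout_x := h.fanout_y
    fanout_y := h.fanout_x
    fanout_G := h.fanout_G
    arg_B := h.arg_C
    B_ne_G := h.C_ne_G
    arg_C := h.arg_B
    C_ne_G := h.B_ne_G
    arg_D := h.arg_D }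

/-- `G` is troubled. [cite: LiYang2022, §4.1 (Case 5)] -/
theorem troubled : C.Troubled G := by
  refine ⟨h.and_G, h.fanout_G, x, y, h.x_ne_y, ?_, h.fanout_x, h.fanout_y⟩
  ext v
  constructor
  · rintro ⟨a, rfl⟩
    rcases fin2_eq_or_eq_rev aX a with rfl | rfl
    · exact Or.inl h.arg_G_x
    · exact Or.inr h.arg_G_y
  · rintro (rfl | rfl)
    · exact ⟨aX, h.arg_G_x⟩
    · exact ⟨aX.rev, h.arg_G_y⟩

/-- `G` is outside the xor-part. [folklore] -/
theorem G_not_mem : G ∉ C.xorPart := C.not_mem_xorPart_of_isAndOp h.and_G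

/-- `D ≠ G`. [folklore] -/
theorem D_ne_G : D ≠ G := fun e => by
  have := h.arg_D; rw [e] at this; exact C.arg_ne_self_of_not_mem h.G_not_mem aD this

end Case5Config

end Semicircuit

open Semicircuit

/-- The common quantifier prefix of the Case 5 sub-claims. [cite: LiYang2022, §4.1 (Case 5)] -/
def LiYang2022_case5_hyp (extra : ∀ {n : ℕ} (C : Semicircuit n) (G : Fin C.m) (x y : Fin n) (B C' D : Fin C.m), Prop) : Prop :=
  ∀ (αφ αI αQ : ℝ), 0 < αφ → αφ < 1 / 2 → 0 < αI → 0 < αQ →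
  ∀ (n d : ℕ) (f : (Fin n → ZMod 2) → Bool), IsAffineDisperser f d →
  ∀ (C : Semicircuit n) (R : RdqSource n), C.Fair → C.ComputesRestr f R → 2 * d + 2 < R.dim → C.Standing R →
  ∀ (G : Fin C.m) (x y : Fin n) (B C' D : Fin C.m) (aX aB aC aD : Fin 2), C.Case5Config G x y B C' D aX aB aC aD →
  extra C G x y B C' D → C.StepGoal f R αφ αI αQ

/-- **Case 5.1**: "When `B = C`, we can always apply a constant substitution to `x` or `y`, or an
affine substitution `x ← y ⊕ c`, such that both `G` and `B` outputs a fixed constant regardless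
of the inputs. We can replace them by constants, making both `x` and `y` non-influential. Hence
`Δμ ≥ 2α_I ≥ δ`." [cite: LiYang2022, §4.1 (Case 5.1)] -/
def LiYang2022_case5_1 : Prop :=
  LiYang2022_case5_hyp fun _ _ _ _ B C' _ => B = C'

/-- **Case 5.2**: `B ≠ C` and "`D` feeds both `B` and `C`". [cite: LiYang2022, §4.1 (Case 5.2)] -/
def LiYang2022_case5_2 : Prop :=
  LiYang2022_case5_hyp fun C _ _ _ B C' D => B ≠ C' ∧ C.Reads D B ∧ C.Reads D C'

/-- **Case 5.3**: `B ≠ C`, `D` does not feed `C`, and "`C` feeds `D` and `D` feeds `B`".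
[cite: LiYang2022, §4.1 (Case 5.3)] -/
def LiYang2022_case5_3 : Prop :=
  LiYang2022_case5_hyp fun C _ _ _ B C' D => B ≠ C' ∧ ¬ C.Reads D C' ∧ C.Reads C' D ∧ C.Reads D B

/-- **Case 5.4**: `B ≠ C` and "`D` is disconnected (in both directions) with `B`".
[cite: LiYang2022, §4.1 (Case 5.4)] -/
def LiYang2022_case5_4 : Prop :=
  LiYang2022_case5_hyp fun C _ _ _ B C' D => B ≠ C' ∧ ¬ C.Reads D B ∧ ¬ C.Reads B D

namespace Semicircuit

variable {n : ℕ} {C : Semicircuit n} {f : (Fin n → ZMod 2) → Bool} {R : RdqSource n} {d : ℕ}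

/-- Two gates outside the xor-part do not read each other. [folklore] -/
theorem not_reads_of_reads {k k' : Fin C.m} (hk : k ∉ C.xorPart) (h : C.Reads k k') : ¬ C.Reads k' k := by
  rintro ⟨a, ha⟩
  obtain ⟨a', ha'⟩ := h
  by_cases hk' : k' ∈ C.xorPart
  · exact hk (C.mem_of_arg_eq k' hk' a' k ha')
  · obtain ⟨ρ, hρ⟩ := C.acyclic
    have h1 := hρ k' hk' a' k ha' hk
    have h2 := hρ k hk a k' ha hk'
    omega

/-- **Case 5 from its four sub-cases** (the configuration from a troubled gate under the standing
assumptions; then `B = C`, or `D` feeds both, or — up to the symmetry `x ↔ y` — `C` feeds `D`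
feeds `B`, or `D` is disconnected with `B`). [cite: LiYang2022, §4.1 (Case 5)] -/
theorem LiYang2022_case5_of_split (h1 : LiYang2022_case5_1) (h2 : LiYang2022_case5_2) (h3 : LiYang2022_case5_3)
    (h4 : LiYang2022_case5_4) : LiYang2022_case5 := by
  intro αφ αI αQ hφ0 hφ hI hQ n d f hf C R hF hC hd hS G hT
  classical
  -- the configuration
  obtain ⟨hand, hG1, x, y, hxy, hr, hx2, hy2⟩ := hT
  have hGK : G ∉ C.xorPart := C.not_mem_xorPart_of_isAndOp hand
  obtain ⟨aX, hGx⟩ : ∃ a, C.arg G a = .var x := by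
    have : (Node.var x : Node n C.m) ∈ Set.range (C.arg G) := by rw [hr]; simp
    exact this
  have hGy : C.arg G aX.rev = .var y := by
    have : (Node.var y : Node n C.m) ∈ Set.range (C.arg G) := by rw [hr]; simp
    obtain ⟨a, ha⟩ := this
    rcases fin2_eq_or_eq_rev aX a with rfl | rfl
    · rw [hGx] at ha; cases ha; exact absurd rfl hxy
    · exact ha
  have hGx1 : (univ.filter fun a' : Fin 2 => C.arg G a' = .var x).card ≤ 1 := by
    rw [card_le_one]
    intro a₁ ha₁ a₂ ha₂
    rw [mem_filter] at ha₁ ha₂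
    have key : ∀ a', C.arg G a' = .var x → a' = aX := by
      intro a' h'
      rcases fin2_eq_or_eq_rev aX a' with e | e
      · exact e
      · rw [e, hGy] at h'; cases h'; exact absurd rfl hxy
    rw [key a₁ ha₁.2, key a₂ ha₂.2]
  have hGy1 : (univ.filter fun a' : Fin 2 => C.arg G a' = .var y).card ≤ 1 := by
    rw [card_le_one]
    intro a₁ ha₁ a₂ ha₂
    rw [mem_filter] at ha₁ ha₂
    have key : ∀ a', C.arg G a' = .var y → a' = aX.rev := by
      intro a' h'
      rcases fin2_eq_or_eq_rev aX a' with e | e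
      · rw [e, hGx] at h'; cases h'; exact absurd rfl hxy
      · exact e
    rw [key a₁ ha₁.2, key a₂ ha₂.2]
  obtain ⟨B, aB, hBG, hBx⟩ := exists_reader_ne (by omega) hGx1
  obtain ⟨C', aC, hCG, hCy⟩ := exists_reader_ne (by omega) hGy1
  obtain ⟨D, aD, hDG⟩ := exists_reader_of_fanout_pos (D := C) (by omega : 0 < C.fanout (.gate G))
  have hcfg : C.Case5Config G x y B C' D aX aB aC aD :=
    ⟨hand, hGx, hGy, hxy, hx2, hy2, hG1, hBx, hBG, hCy, hCG, hDG⟩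
  have hDK : D ∉ C.xorPart := fun hDK => hGK (C.mem_of_arg_eq D hDK aD G hDG)
  -- the case distinction
  by_cases h51 : B = C'
  · exact h1 αφ αI αQ hφ0 hφ hI hQ n d f hf C R hF hC hd hS G x y B C' D aX aB aC aD hcfg h51
  by_cases h52 : C.Reads D B ∧ C.Reads D C'
  · exact h2 αφ αI αQ hφ0 hφ hI hQ n d f hf C R hF hC hd hS G x y B C' D aX aB aC aD hcfg ⟨h51, h52⟩
  rw [not_and_or] at h52
  -- `B` and `C'` do not both feed `D` (its other wire would be both)
  have hBC : ¬ (C.Reads B D ∧ C.Reads C' D) := by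
    rintro ⟨⟨a, ha⟩, ⟨a', ha'⟩⟩
    have haD : a = aD.rev := by
      rcases fin2_eq_or_eq_rev aD a with e | e
      · rw [e, hDG] at ha; cases ha; exact absurd rfl hBG
      · exact e
    have haD' : a' = aD.rev := by
      rcases fin2_eq_or_eq_rev aD a' with e | e
      · rw [e, hDG] at ha'; cases ha'; exact absurd rfl hCG
      · exact e
    rw [haD] at ha; rw [haD', ha] at ha'; cases ha'; exact h51 rfl
  rcases h52 with hDB | hDC
  · -- `D` does not feed `B`
    by_cases hBD : C.Reads B D
    · -- then `C'` does not feed `D`; is `D → C'`?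
      have hCD : ¬ C.Reads C' D := fun h => hBC ⟨hBD, h⟩
      by_cases hDC : C.Reads D C'
      · -- symmetric Case 5.3: `B` feeds `D` feeds `C'`
        exact h3 αφ αI αQ hφ0 hφ hI hQ n d f hf C R hF hC hd hS G y x C' B D aX.rev aC aB aD hcfg.symm
          ⟨Ne.symm h51, hDB, hBD, hDC⟩
      · -- symmetric Case 5.4: `D` disconnected with `C'`
        exact h4 αφ αI αQ hφ0 hφ hI hQ n d f hf C R hF hC hd hS G y x C' B D aX.rev aC aB aD hcfg.symm
          ⟨Ne.symm h51, hDC, hCD⟩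
    · exact h4 αφ αI αQ hφ0 hφ hI hQ n d f hf C R hF hC hd hS G x y B C' D aX aB aC aD hcfg ⟨h51, hDB, hBD⟩
  · -- `D` does not feed `C'`
    by_cases hCD : C.Reads C' D
    · have hBD : ¬ C.Reads B D := fun h => hBC ⟨h, hCD⟩
      by_cases hDB : C.Reads D B
      · -- Case 5.3
        exact h3 αφ αI αQ hφ0 hφ hI hQ n d f hf C R hF hC hd hS G x y B C' D aX aB aC aD hcfg ⟨h51, hDC, hCD, hDB⟩
      · -- Case 5.4
        exact h4 αφ αI αQ hφ0 hφ hI hQ n d f hf C R hF hC hd hS G x y B C' D aX aB aC aD hcfg ⟨h51, hDB, hBD⟩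
    · -- symmetric Case 5.4: `D` disconnected with `C'`
      exact h4 αφ αI αQ hφ0 hφ hI hQ n d f hf C R hF hC hd hS G y x C' B D aX.rev aC aB aD hcfg.symm
        ⟨Ne.symm h51, hDC, hCD⟩

end Semicircuit

end Literature.Computability.Complexity
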